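import Literature.NumberTheory.EllipticCurves.Greenberg1999.TwoTorsionMuInvariant
import Literature.NumberTheory.EllipticCurves.IsogenyTwoTorsionProofs
import HarnessLib

/-!
# Greenberg's "odd" condition on a rational point of order `2` is DUAL under the `2`-isogeny
# `E → E/⟨P⟩` (proofs only; archimedean half)

Topic `NumberTheory/EllipticCurves/Greenberg1999`; theorem-only companion (no definition, no named
fact, no instance, no `sorry`) of `TwoTorsionMuInvariant`, which types R. Greenberg, LNM 1716 (1999),
§5 (Props. 5.13 / 5.14 at `p = 2`) with the predicates `TwoTorsionRamifiedAtTwo x := v₂(x) < 0`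
("`Φ = ⟨P⟩ ⊆ C₂`") and `TwoTorsionOdd W x :=` "`x` is the least real root of the `2`-division cubic"
("`Φ ⊆ C_∞ = (E[2^∞]⁻)_div`").  Sibling `TwoTorsionRamifiedIsogenyDualProofs` does the `2`-adic half
and assembles Greenberg's configurations.

**Setting (the tree's currency for `P ↦ P'`).** `E/ℚ` with a rational point `P` of order `2`,
`φ : E → E' = E/⟨P⟩` and `P' ∈ E'(ℚ)` the generator of the kernel of the dual isogeny `φ̂`.  A change
of variables `C = (u, r, s, t)` over `ℚ` puts an equation `W` of `E` in two-torsion normal form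
`V = C • W : y² = x³ + ax² + bx` with `P ↦ T = (0,0)`, so `P = (C.r, C.t)` on `W`
(`hasRationalTwoTorsionX_of_isTwoTorsionNF_smul`; e.g. `C = (1, x(P), -a₁/2, y(P))`, tree
`isTwoTorsionNF_smul_of_two_nsmul_eq_zero`); Silverman's explicit `2`-isogeny (AEC III.4.5, tree
`IsogenyTwoTorsionProofs`) has codomain `V' = V.twoIsogenyCodomain : y² = x³ - 2ax² + (a² - 4b)x`,
whose `T' = (0,0)` generates `ker φ̂` (tree `TwoIsogenyDualPoints`/`TwoIsogenyDualKernel`: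
`ψ ∘ φ = [2]`, `ker ψ = {O, T'}`); ANY equation `W'` of `E'` is linked by a change of variables `C'`
with `C' • W' = V'`, under which `T' ↦ P' = (C'.r, C'.t)`.

**Theorems.**
* §1 `hasRationalTwoTorsionX_of_isTwoTorsionNF_smul` — if `C • W` is in two-torsion normal form then
  `(C.r, C.t)` is a rational point of order `2` of `W` and `C.r` is a root of the `2`-division cubic;
  `4a₂(C • W) = u⁻²(b₂ + 12r)`, `2a₄(C • W) = u⁻⁴(b₄ + r b₂ + 6r²)`.
* §2 `twoTorsionOdd_smul_iff` — "odd" is invariant under changes of variables (`x = u²x' + r`,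
  `u² > 0` preserves the order of the real roots); `twoTorsionOdd_zero_iff_of_isTwoTorsionNF` — on
  `y² = x(x² + ax + b)`, `T` is odd iff every real root of `x² + ax + b` is `≥ 0`; the real-algebra
  lemma `forall_root_nonneg_iff_not_dual` — for `b ≠ 0`, `a² ≠ 4b`, EXACTLY ONE of `x² + ax + b`,
  `x² - 2ax + (a² - 4b)` has all its real roots `≥ 0`; hence
  **`twoTorsionOdd_iff_not_of_twoIsogeny` : `⟨P⟩` is odd ⟺ `⟨P'⟩` is NOT odd.**
  (Lattice picture, not formalised: `C_∞` is the `2`-power torsion of the image of the imaginary axis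
  `iℝ ⊂ ℂ`; `φ = id_ℂ` maps it onto `C_∞(E')`, and `ker φ̂ = φ(E[2])` meets it iff `P ∉ C_∞(E)`.)

Written for the BSD cell `bsd-2adic` (the rational-`2`-torsion stratum (β) of the off-habitat
complement at a good ordinary `2`).  Nothing about BSD, `μ`, `λ` or Selmer groups is claimed: these are
statements about real and rational numbers attached to Weierstrass equations.

## References
* [GreenbergLNM1716] R. Greenberg, *Iwasawa theory for elliptic curves*, LNM 1716 (1999), §5
  pp. 120–122 (Props. 5.13, 5.14, the Remark "the point in `E(ℝ)[2]` whose `x`-coordinate is minimal";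
  chunks p0168–p0176).
* [SilvermanAEC2009] J. H. Silverman, *The Arithmetic of Elliptic Curves*, 2nd ed., GTM 106 (2009),
  III.1 (changes of variables), III.2.3 (`ψ₂`), III.4 Example 4.5 (the explicit `2`-isogeny),
  III.6.1–6.2 (dual isogeny).
-/

set_option autoImplicit false

open WeierstrassCurve

namespace Literature.NumberTheory.EllipticCurves.Greenberg1999

/-! ### §1. A two-torsion normal form `C • W` exhibits the rational `2`-torsion point `(C.r, C.t)` -/

section NFData

variable {K : Type*} [Field K] (W : WeierstrassCurve K) (C : VariableChange K)

/-- If `C • W` is in two-torsion normal form (`a₁ = a₃ = a₆ = 0`), then `2·C.t + a₁·C.r + a₃ = 0`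
(from `a₃(C • W) = u⁻³(a₃ + r a₁ + 2t) = 0`). [cite: SilvermanAEC2009, III.1 Table 3.1] -/
theorem two_mul_t_add_eq_zero_of_isTwoTorsionNF_smul [h : (C • W).IsTwoTorsionNF] :
    2 * C.t + W.a₁ * C.r + W.a₃ = 0 := by
  have h₃ : (C • W).a₃ = 0 := h.a₃
  rw [variableChange_a₃] at h₃
  have hu : ((C.u⁻¹ : Kˣ) : K) ^ 3 ≠ 0 := pow_ne_zero _ (Units.ne_zero _)
  have := (mul_eq_zero.mp h₃).resolve_left hu
  linear_combination this

/-- If `C • W` is in two-torsion normal form, then `(C.r, C.t)` lies on `W`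
(from `a₆(C • W) = u⁻⁶(a₆ + r a₄ + r² a₂ + r³ - t a₃ - t² - r t a₁) = 0`).
[cite: SilvermanAEC2009, III.1 Table 3.1] -/
theorem equation_r_t_of_isTwoTorsionNF_smul [h : (C • W).IsTwoTorsionNF] :
    W.toAffine.Equation C.r C.t := by
  have h₆ : (C • W).a₆ = 0 := h.a₆
  rw [variableChange_a₆] at h₆
  have hu : ((C.u⁻¹ : Kˣ) : K) ^ 6 ≠ 0 := pow_ne_zero _ (Units.ne_zero _)
  have := (mul_eq_zero.mp h₆).resolve_left hu
  rw [WeierstrassCurve.Affine.equation_iff]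
  linear_combination -this

/-- `a₂` of a two-torsion normal form `C • W`: `4·a₂(C • W) = u⁻²·(b₂ + 12 r)` (`b₂(C • W) = 4a₂`
since `a₁ = 0`). [cite: SilvermanAEC2009, III.1 Table 3.1] -/
theorem four_mul_a₂_of_isTwoTorsionNF_smul [h : (C • W).IsTwoTorsionNF] :
    4 * (C • W).a₂ = ((C.u⁻¹ : Kˣ) : K) ^ 2 * (W.b₂ + 12 * C.r) := by
  have hb : (C • W).b₂ = (C • W).a₁ ^ 2 + 4 * (C • W).a₂ := rfl
  have h₁ : (C • W).a₁ = 0 := h.a₁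
  rw [← variableChange_b₂, hb, h₁]
  ring

/-- `a₄` of a two-torsion normal form `C • W`: `2·a₄(C • W) = u⁻⁴·(b₄ + r b₂ + 6 r²)` (`b₄(C • W) = 2a₄`
since `a₁ = a₃ = 0`). [cite: SilvermanAEC2009, III.1 Table 3.1] -/
theorem two_mul_a₄_of_isTwoTorsionNF_smul [h : (C • W).IsTwoTorsionNF] :
    2 * (C • W).a₄ = ((C.u⁻¹ : Kˣ) : K) ^ 4 * (W.b₄ + C.r * W.b₂ + 6 * C.r ^ 2) := by
  have hb : (C • W).b₄ = 2 * (C • W).a₄ + (C • W).a₁ * (C • W).a₃ := rfl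
  have h₁ : (C • W).a₁ = 0 := h.a₁
  rw [← variableChange_b₄, hb, h₁]
  ring

end NFData

section NFDataRat

variable (W : WeierstrassCurve ℚ) (C : VariableChange ℚ)

/-- **A two-torsion normal form `C • W` over `ℚ` exhibits the rational point `P = (C.r, C.t)` of order
`2` of `W`** (`HasRationalTwoTorsionX W C.r`): the point `T = (0,0)` of `C • W` read back on `W`.
[cite: SilvermanAEC2009, III.1 Table 3.1 and X.4.9 (proof)] -/
theorem hasRationalTwoTorsionX_of_isTwoTorsionNF_smul [(C • W).IsTwoTorsionNF] :
    HasRationalTwoTorsionX W C.r :=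
  ⟨C.t, equation_r_t_of_isTwoTorsionNF_smul W C, two_mul_t_add_eq_zero_of_isTwoTorsionNF_smul W C⟩

/-- Hence `C.r` is a root of the `2`-division cubic `4x³ + b₂x² + 2b₄x + b₆` of `W`.
[cite: SilvermanAEC2009, III.2.3 (b) (ψ₂)] -/
theorem fourXCubed_r_eq_zero_of_isTwoTorsionNF_smul [(C • W).IsTwoTorsionNF] :
    4 * C.r ^ 3 + W.b₂ * C.r ^ 2 + 2 * W.b₄ * C.r + W.b₆ = 0 :=
  fourXCubed_add_eq_zero_of_twoTorsion (equation_r_t_of_isTwoTorsionNF_smul W C)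
    (two_mul_t_add_eq_zero_of_isTwoTorsionNF_smul W C)

end NFDataRat

/-! ### §2. The archimedean condition "odd" along the isogeny -/

section Odd

/-- **"Odd" is invariant under rational changes of variables**: the real roots of the `2`-division
cubic of `C • W` are the `(x - r)/u²` for the real roots `x` of that of `W`
(`4ρ³ + b₂'ρ² + 2b₄'ρ + b₆' = u⁻⁶·(4x³ + b₂x² + 2b₄x + b₆)` at `x = u²ρ + r`), and `u² > 0` preserves
their order. [cite: SilvermanAEC2009, III.1 Table 3.1] [cite: GreenbergLNM1716, §5 Remark (chunk p0174)] -/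
theorem twoTorsionOdd_smul_iff (W : WeierstrassCurve ℚ) (C : VariableChange ℚ) (ρ : ℚ) :
    TwoTorsionOdd (C • W) ρ ↔ TwoTorsionOdd W ((C.u : ℚ) ^ 2 * ρ + C.r) := by
  have hU : ((C.u⁻¹ : ℚˣ) : ℚ) = (C.u : ℚ)⁻¹ := Units.val_inv_eq_inv_val C.u
  have hu0 : ((C.u : ℚ) : ℝ) ≠ 0 := by exact_mod_cast Units.ne_zero _
  have hb₂ : (C • W).b₂ = (C.u : ℚ)⁻¹ ^ 2 * (W.b₂ + 12 * C.r) := by rw [variableChange_b₂, hU]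
  have hb₄ : (C • W).b₄ = (C.u : ℚ)⁻¹ ^ 4 * (W.b₄ + C.r * W.b₂ + 6 * C.r ^ 2) := by
    rw [variableChange_b₄, hU]
  have hb₆ : (C • W).b₆ = (C.u : ℚ)⁻¹ ^ 6 * (W.b₆ + 2 * C.r * W.b₄ + C.r ^ 2 * W.b₂ + 4 * C.r ^ 3) := by
    rw [variableChange_b₆, hU]
  -- the key identity between the two cubics, `x = u²σ + r`
  have key : ∀ σ : ℝ, 4 * σ ^ 3 + ((C • W).b₂ : ℝ) * σ ^ 2 + 2 * ((C • W).b₄ : ℝ) * σ + ((C • W).b₆ : ℝ)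
      = (((C.u : ℚ) : ℝ) ^ 6)⁻¹ * (4 * (((C.u : ℚ) : ℝ) ^ 2 * σ + C.r) ^ 3
        + (W.b₂ : ℝ) * (((C.u : ℚ) : ℝ) ^ 2 * σ + C.r) ^ 2
        + 2 * (W.b₄ : ℝ) * (((C.u : ℚ) : ℝ) ^ 2 * σ + C.r) + (W.b₆ : ℝ)) := by
    intro σ
    rw [hb₂, hb₄, hb₆]
    push_cast
    field_simp
    ring
  have hu6 : (((C.u : ℚ) : ℝ) ^ 6)⁻¹ ≠ 0 := inv_ne_zero (pow_ne_zero _ hu0)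
  have hu2 : (0 : ℝ) < ((C.u : ℚ) : ℝ) ^ 2 := by positivity
  constructor
  · -- from `C • W` to `W`: a real root `x` of `W`'s cubic gives the root `(x - r)/u²` of `(C • W)`'s
    intro h x hx
    have hσ := h ((x - C.r) / ((C.u : ℚ) : ℝ) ^ 2) (by
      rw [key]
      have : ((C.u : ℚ) : ℝ) ^ 2 * ((x - C.r) / ((C.u : ℚ) : ℝ) ^ 2) + C.r = x := by
        field_simp
        ring
      rw [this, hx, mul_zero])
    -- `ρ ≤ (x - r)/u²` ⟹ `u²ρ + r ≤ x`
    have := (le_div_iff₀ hu2).mp hσ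
    push_cast
    linarith
  · -- from `W` to `C • W`
    intro h σ hσ
    have hx := h (((C.u : ℚ) : ℝ) ^ 2 * σ + C.r) (by
      have h0 := key σ
      rw [hσ] at h0
      rcases mul_eq_zero.mp h0.symm with h1 | h1
      · exact absurd h1 hu6
      · exact_mod_cast h1)
    push_cast at hx
    nlinarith [hx, hu2, mul_le_mul_of_nonneg_left (le_refl σ) hu2.le]

/-- **On a two-torsion normal form `y² = x³ + ax² + bx`, `T = (0,0)` is odd iff every real root of
`x² + ax + b` is `≥ 0`** (the `2`-division cubic is `4x(x² + ax + b)`).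
[cite: GreenbergLNM1716, §5 Remark (chunk p0174)] -/
theorem twoTorsionOdd_zero_iff_of_isTwoTorsionNF (V : WeierstrassCurve ℚ) [hV : V.IsTwoTorsionNF] :
    TwoTorsionOdd V 0 ↔ ∀ ρ : ℝ, ρ ^ 2 + (V.a₂ : ℝ) * ρ + (V.a₄ : ℝ) = 0 → 0 ≤ ρ := by
  have hb₂ : V.b₂ = 4 * V.a₂ := by
    rw [show V.b₂ = V.a₁ ^ 2 + 4 * V.a₂ from rfl, hV.a₁]; ring
  have hb₄ : V.b₄ = 2 * V.a₄ := by
    rw [show V.b₄ = 2 * V.a₄ + V.a₁ * V.a₃ from rfl, hV.a₁]; ring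
  have hb₆ : V.b₆ = 0 := by
    rw [show V.b₆ = V.a₃ ^ 2 + 4 * V.a₆ from rfl, hV.a₃, hV.a₆]; ring
  unfold TwoTorsionOdd
  rw [hb₂, hb₄, hb₆]
  push_cast
  constructor
  · intro h ρ hρ
    by_cases hρ0 : ρ = 0
    · exact hρ0 ▸ le_rfl
    · exact h ρ (by linear_combination 4 * ρ * hρ)
  · intro h ρ hρ
    by_cases hρ0 : ρ = 0
    · exact hρ0 ▸ le_rfl
    · refine h ρ ?_
      have h4 : (4 * ρ) * (ρ ^ 2 + (V.a₂ : ℝ) * ρ + (V.a₄ : ℝ)) = 0 := by linear_combination hρ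
      exact (mul_eq_zero.mp h4).resolve_left (mul_ne_zero four_ne_zero hρ0)

/-- **Real algebra: for `b ≠ 0` and `a² ≠ 4b`, EXACTLY ONE of the quadratics `x² + ax + b` and
`x² - 2ax + (a² - 4b)` has all its real roots `≥ 0`.**  (`b < 0`: the first has roots of both signs,
the second none; `b > 0`, `a² < 4b`: the first has none, the second has `a - 2√b < 0`; `b > 0`,
`a² > 4b`: the roots of the first have the sign of `-a`, those of the second (`(x - a)² = 4b < a²`) the
sign of `a`.) [folklore] -/
private theorem forall_root_nonneg_iff_not_dual {a b : ℝ} (hb : b ≠ 0) (hab : a ^ 2 - 4 * b ≠ 0) :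
    (∀ ρ : ℝ, ρ ^ 2 + a * ρ + b = 0 → 0 ≤ ρ) ↔
      ¬ (∀ ρ : ℝ, ρ ^ 2 + (-2 * a) * ρ + (a ^ 2 - 4 * b) = 0 → 0 ≤ ρ) := by
  rcases lt_or_gt_of_ne hb with hb | hb
  · -- `b < 0`: first false (negative root), second vacuously true
    have hD : 0 < a ^ 2 - 4 * b := by nlinarith [sq_nonneg a]
    set d := Real.sqrt (a ^ 2 - 4 * b) with hd
    have hd2 : d ^ 2 = a ^ 2 - 4 * b := by rw [hd, Real.sq_sqrt hD.le]
    have hda : |a| < d := by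
      rw [hd, ← Real.sqrt_sq_eq_abs]
      exact Real.sqrt_lt_sqrt (sq_nonneg a) (by linarith)
    constructor
    · intro h1 _
      have hneg : (-a - d) / 2 < 0 := by
        have := neg_abs_le a
        linarith
      have hroot : ((-a - d) / 2) ^ 2 + a * ((-a - d) / 2) + b = 0 := by nlinarith [hd2]
      exact absurd (h1 _ hroot) (not_le.mpr hneg)
    · intro h2
      exfalso
      refine h2 fun ρ hρ ↦ ?_
      -- no real root: `(ρ - a)² = 4b < 0`
      nlinarith [sq_nonneg (ρ - a)]
  · -- `b > 0`
    rcases lt_or_gt_of_ne hab with hD | hD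
    · -- `a² < 4b`: first vacuously true, second false (`a - 2√b < 0`)
      set e := Real.sqrt b with he
      have he2 : e ^ 2 = b := by rw [he, Real.sq_sqrt hb.le]
      have he0 : 0 < e := by rw [he]; exact Real.sqrt_pos.mpr hb
      have hae : a < 2 * e := by
        have : |a| < 2 * e := by
          have h4 : a ^ 2 < (2 * e) ^ 2 := by nlinarith
          exact abs_lt_of_sq_lt_sq h4 (by linarith)
        exact lt_of_le_of_lt (le_abs_self a) this
      constructor
      · intro _ h2
        have hneg : a - 2 * e < 0 := by linarith
        have hroot : (a - 2 * e) ^ 2 + (-2 * a) * (a - 2 * e) + (a ^ 2 - 4 * b) = 0 := by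
          nlinarith [he2]
        exact absurd (h2 _ hroot) (not_le.mpr hneg)
      · intro _ ρ hρ
        exfalso
        -- no real root: `(ρ + a/2)² = (a² - 4b)/4 < 0`
        nlinarith [sq_nonneg (2 * ρ + a)]
    · -- `a² > 4b`, `b > 0`: the sign of `a` decides
      rcases lt_trichotomy a 0 with ha | ha | ha
      · -- `a < 0`: first true, second false
        set e := Real.sqrt b with he
        have he2 : e ^ 2 = b := by rw [he, Real.sq_sqrt hb.le]
        have he0 : 0 < e := by rw [he]; exact Real.sqrt_pos.mpr hb
        constructor
        · intro _ h2
          have hneg : a - 2 * e < 0 := by linarith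
          have hroot : (a - 2 * e) ^ 2 + (-2 * a) * (a - 2 * e) + (a ^ 2 - 4 * b) = 0 := by
            nlinarith [he2]
          exact absurd (h2 _ hroot) (not_le.mpr hneg)
        · intro _ ρ hρ
          -- `ρ(ρ + a) = -b < 0` and `a < 0` force `ρ > 0`
          nlinarith
      · exact absurd (by rw [ha]; ring : a ^ 2 - 4 * b = -(4 * b)) (by intro h; rw [h] at hD; linarith)
      · -- `a > 0`: first false, second true
        set d := Real.sqrt (a ^ 2 - 4 * b) with hd
        have hd2 : d ^ 2 = a ^ 2 - 4 * b := by rw [hd, Real.sq_sqrt hD.le]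
        have hd0 : 0 < d := by rw [hd]; exact Real.sqrt_pos.mpr hD
        constructor
        · intro h1 _
          have hneg : (-a - d) / 2 < 0 := by linarith
          have hroot : ((-a - d) / 2) ^ 2 + a * ((-a - d) / 2) + b = 0 := by nlinarith [hd2]
          exact absurd (h1 _ hroot) (not_le.mpr hneg)
        · intro h2
          exfalso
          refine h2 fun ρ hρ ↦ ?_
          -- `ρ(ρ - 2a) = 4b - a² < 0` and `a > 0` force `0 < ρ < 2a`
          by_contra hneg
          nlinarith [mul_pos_of_neg_of_neg (not_le.mp hneg) (by linarith : ρ - 2 * a < 0)]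

/-- **"Odd" is DUAL along the explicit `2`-isogeny of a normal form**: on `V : y² = x³ + ax² + bx`
(elliptic, so `b ≠ 0`, `a² ≠ 4b`) the point `T = (0,0)` is odd iff on
`V' = V.twoIsogenyCodomain : y² = x³ - 2ax² + (a² - 4b)x` the point `T' = (0,0)` — the generator of
the kernel of the dual isogeny — is NOT odd. [cite: GreenbergLNM1716, §5 definition of "odd" (chunk p0168) and Remark (chunk p0174)] [cite: SilvermanAEC2009, III.4 Example 4.5] -/
theorem twoTorsionOdd_zero_iff_not_twoIsogenyCodomain (V : WeierstrassCurve ℚ) [V.IsTwoTorsionNF]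
    [V.IsElliptic] : TwoTorsionOdd V 0 ↔ ¬ TwoTorsionOdd V.twoIsogenyCodomain 0 := by
  rw [twoTorsionOdd_zero_iff_of_isTwoTorsionNF V,
    twoTorsionOdd_zero_iff_of_isTwoTorsionNF V.twoIsogenyCodomain, twoIsogenyCodomain_a₂,
    twoIsogenyCodomain_a₄]
  push_cast
  have hb : (V.a₄ : ℝ) ≠ 0 := by exact_mod_cast V.a₄_ne_zero
  have hab : (V.a₂ : ℝ) ^ 2 - 4 * (V.a₄ : ℝ) ≠ 0 := by exact_mod_cast V.a₂_sq_sub_ne_zero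
  exact forall_root_nonneg_iff_not_dual hb hab

/-- **"Odd" is DUAL under `P ↦ P'`** (any models): if `C • W` is a two-torsion normal form of `W`
(so `P = (C.r, C.t)` is a rational point of order `2` of `W`) and `C' • W'` is the codomain
`(C • W).twoIsogenyCodomain` of its explicit `2`-isogeny (so `W'` is a model of `W/⟨P⟩` and
`P' = (C'.r, C'.t)` generates the kernel of the dual isogeny), then `⟨P⟩` is odd iff `⟨P'⟩` is not:
`⟨P⟩ ⊆ C_∞(E) ⟺ ⟨P'⟩ ⊄ C_∞(E')`. [cite: GreenbergLNM1716, §5 (chunk p0168) and Remark (chunk p0174)] [cite: SilvermanAEC2009, III.4 Example 4.5 and III.6.1] -/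
theorem twoTorsionOdd_iff_not_of_twoIsogeny (W W' : WeierstrassCurve ℚ) [W.IsElliptic]
    (C C' : VariableChange ℚ) [(C • W).IsTwoTorsionNF]
    (hlink : C' • W' = (C • W).twoIsogenyCodomain) :
    TwoTorsionOdd W C.r ↔ ¬ TwoTorsionOdd W' C'.r := by
  have h1 : TwoTorsionOdd W C.r ↔ TwoTorsionOdd (C • W) 0 := by
    rw [twoTorsionOdd_smul_iff]; simp
  have h2 : TwoTorsionOdd W' C'.r ↔ TwoTorsionOdd (C' • W') 0 := by
    rw [twoTorsionOdd_smul_iff]; simp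
  rw [h1, h2, hlink]
  exact twoTorsionOdd_zero_iff_not_twoIsogenyCodomain (C • W)

end Odd

end Literature.NumberTheory.EllipticCurves.Greenberg1999
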